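/-
Copyright: internal research formalization. Source texts: G. Kempf, F. Knudsen, D. Mumford,
B. Saint-Donat, Toroidal Embeddings I (LNM 339, Springer 1973) [KempfEtAl1973], Ch. II §1 Def. 5
(charts of a conical polyhedral complex with integral structure; compatibility on overlaps) and
§2 (Theorems 4*, 9*, 11*); K. Kato, Toric singularities, Amer. J. Math. 116 (1994) [Kato1994],
(9.6)–(9.8); W. Fulton, Introduction to Toric Varieties [Fulton1993Toric], §1.2 p. 9, §1.4 p. 21.
-/
import Literature.Geometry.PolyhedralFans.FlagCones
import Literature.Geometry.PolyhedralFans.LinkTransportCount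
import Literature.Geometry.PolyhedralFans.LinkedRefinement
import Literature.Geometry.PolyhedralFans.MultiStarSubdivision
import HarnessLib

/-!
# Links of a conical complex supply the transport hypotheses

Topic: `Literature/Geometry/PolyhedralFans` (LINKED-KKMS programme, glue between the statement
file `LinkedRefinement.lean` and the transport files `LinkTransport`, `LinkTransportCount`,
`FlagCones`). Proofs only; no new notions, no named facts.

A link `ℓ : Δ₀.Link` ([KempfEtAl1973] II §1 Def. 5: two cones `src, tgt` of the fan identified
by mutually inverse `ℚ`-linear maps `toLin, invLin` preserving lattice points OF THE CONES) gives
the three hypotheses under which the transport lemmas are stated, on the subspace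
`U = span src`:

* `Fan.Link.eq_zero_of_toLin_eq_zero` — `toLin` is injective on `span src` (the inverse identity
  `invLin ∘ toLin = id` extends from `src` to its span by linearity);
* `Fan.Link.integral_span` — `toLin` maps the lattice points of `span src` to lattice points, for a
  RATIONAL fan: **every lattice point of the span of a rational cone is a difference of two lattice
  points of the cone** (`exists_sub_of_mem_span_of_mem_latticeN`, [Fulton1993Toric] §1.2: add a
  large multiple of the sum of the lattice generators);
* `Fan.Link.exists_latticeN_preimage` — every lattice point of `toLin (span src) = span tgt` is the
  image of a lattice point of `span src`;

and the two-sided compatibility of a refinement with a link is the cone-set equality used by the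
transport lemmas (`Fan.linkCompatible_and_symm_iff`). Consequences recorded for the consumers
(A3/A5 of the programme): faces of `src` are carried to cones of `Δ₀`
(`Fan.Link.map_mem_cones_of_le`), barycentres and primitive ray generators are equivariant
(`Fan.Link.bary_map`, `Fan.Link.bary_tgt`), the cone count is invariant
(`Fan.Link.conePMult_map`), link-compatibility survives a linked star subdivision
(`Fan.linkCompatible_starSubdivision_cones`) and, more generally, the SIMULTANEOUS star
subdivision through a link-closed separated list of points in any order
(`Fan.mapOn_restrict_starIter_cones_of_separated`, `Fan.linkCompatible_starIter`: points outside
the cell are dropped by `Fan.starIter_filter_cones`, the order inside the cell is irrelevant by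
`Fan.starIter_cones_eq_of_separated`), and the `v`-coordinate takes equal values at linked points
(`Fan.starCoord_eq_of_linkCompatible`). The same hypotheses and consequences are derived for the
links of a FAMILY of fans in separate coordinate spaces (`Fan.FamilyLink.*`,
`Fan.familyLinkCompatible_and_symm_iff`, `Fan.familyLinkCompatible_starIter`,
`Fan.starCoord_eq_of_familyLinkCompatible`), the form consumed by Kato (10.4).
-/

noncomputable section

namespace Literature.Geometry.PolyhedralFans

open PointedCone Finset

/-! ## Lattice points of the span of a rational cone -/

section SpanLattice

variable {κ : Type*}

/-- **A lattice point of the span of a rational cone is a difference of two lattice points of the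
cone**: if `σ = hull T` with `T` finite in `ℤ^κ` and `x ∈ span σ ∩ ℤ^κ`, then
`x = (x + m Σ_{t∈T} t) − m Σ_{t∈T} t` with both terms lattice points of `σ` for `m ≫ 0`
([Fulton1993Toric] §1.2 p. 9: `σ` spans `σ + (−σ)`; integrality is kept by integer shifts).
[cite: Fulton1993Toric, §1.2 p. 9] -/
theorem exists_sub_of_mem_span_of_mem_latticeN {σ : PointedCone ℚ (κ → ℚ)} (hrat : IsRationalCone σ)
    {x : κ → ℚ} (hx : x ∈ Submodule.span ℚ (σ : Set (κ → ℚ))) (hxN : x ∈ latticeN κ) :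
    ∃ a ∈ σ, ∃ b ∈ σ, a ∈ latticeN κ ∧ b ∈ latticeN κ ∧ x = a - b := by
  classical
  obtain ⟨T, hTN, hσT⟩ := hrat
  rw [hσT, span_coe_hull] at hx
  obtain ⟨f, -, hfx⟩ := Submodule.mem_span_finset.mp hx
  -- an integer bound for the coefficients
  obtain ⟨m, hbound⟩ : ∃ m : ℕ, ∀ t ∈ T, |f t| ≤ (m : ℚ) := by
    refine ⟨∑ s ∈ T, ⌈|f s|⌉₊, fun t ht => (Nat.le_ceil _).trans ?_⟩
    have h2 : ⌈|f t|⌉₊ ≤ ∑ s ∈ T, ⌈|f s|⌉₊ :=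
      Finset.single_le_sum (f := fun s => ⌈|f s|⌉₊) (fun _ _ => Nat.zero_le _) ht
    exact_mod_cast h2
  set b : κ → ℚ := ∑ t ∈ T, (m : ℚ) • t with hb
  have hbσ : b ∈ σ := by
    rw [hσT]; exact sum_smul_mem_hull fun _ _ => Nat.cast_nonneg m
  have hbN : b ∈ latticeN κ := by
    have := sum_intCast_smul_mem_latticeN (fun t ht => hTN (Finset.mem_coe.mpr ht)) fun _ => (m : ℤ)
    simpa only [Int.cast_natCast] using this
  refine ⟨x + b, ?_, b, hbσ, (latticeN κ).add_mem hxN hbN, hbN, (add_sub_cancel_right x b).symm⟩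
  have hsum : x + b = ∑ t ∈ T, (f t + m) • t := by
    rw [← hfx, hb, ← Finset.sum_add_distrib]
    exact Finset.sum_congr rfl fun t _ => by rw [add_smul]
  rw [hsum, hσT]
  refine sum_smul_mem_hull fun t ht => ?_
  have := hbound t ht
  have h3 : -(m : ℚ) ≤ f t := by linarith [neg_abs_le (f t)]
  linarith

end SpanLattice

/-! ## The transport hypotheses from a pair of mutually inverse cone maps -/

section ConeIso

variable {κ₁ κ₂ : Type*}
variable {src : PointedCone ℚ (κ₁ → ℚ)} {tgt : PointedCone ℚ (κ₂ → ℚ)}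
variable {toLin : (κ₁ → ℚ) →ₗ[ℚ] (κ₂ → ℚ)} {invLin : (κ₂ → ℚ) →ₗ[ℚ] (κ₁ → ℚ)}

/-- The inverse identity on the source cone extends to its span.
[cite: KempfEtAl1973, Ch. II §1 Def. 5] -/
theorem leftInv_of_mem_span (hleft : ∀ x ∈ src, invLin (toLin x) = x) {x : κ₁ → ℚ}
    (hx : x ∈ Submodule.span ℚ (src : Set (κ₁ → ℚ))) : invLin (toLin x) = x := by
  have h := LinearMap.eqOn_span (R := ℚ) (f := invLin ∘ₗ toLin) (g := LinearMap.id)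
    (fun y hy => hleft y hy) hx
  simpa using h

/-- For mutually inverse cone maps the image of the source cone is the target cone.
[cite: KempfEtAl1973, Ch. II §1 Def. 5] -/
theorem map_eq_of_mapsTo (hmaps : ∀ x ∈ src, toLin x ∈ tgt) (hmapsInv : ∀ y ∈ tgt, invLin y ∈ src)
    (hright : ∀ y ∈ tgt, toLin (invLin y) = y) : src.map toLin = tgt := by
  ext y
  rw [PointedCone.mem_map]
  constructor
  · rintro ⟨x, hx, rfl⟩
    exact hmaps x hx
  · intro hy
    exact ⟨invLin y, hmapsInv y hy, hright y hy⟩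

/-- **A cone isomorphism is injective on the span of the source** (kernel form).
[cite: KempfEtAl1973, Ch. II §1 Def. 5] -/
theorem eq_zero_of_map_eq_zero_of_leftInv (hleft : ∀ x ∈ src, invLin (toLin x) = x) :
    ∀ x ∈ Submodule.span ℚ (src : Set (κ₁ → ℚ)), toLin x = 0 → x = 0 := by
  intro x hx h0
  rw [← leftInv_of_mem_span hleft hx, h0, map_zero]

/-- A cone map onto `tgt` carries `span src` onto `span tgt`. [cite: KempfEtAl1973, Ch. II §1 Def. 5] -/
theorem map_span_eq_of_map_eq (hmap : src.map toLin = tgt) :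
    (Submodule.span ℚ (src : Set (κ₁ → ℚ))).map toLin = Submodule.span ℚ (tgt : Set (κ₂ → ℚ)) := by
  rw [← span_coe_map, hmap]

/-- **The lattice condition extends from the cone to its span** for a rational source cone:
`toLin` maps the lattice points of `span src` to lattice points.
[cite: KempfEtAl1973, Ch. II §1 Def. 5] -/
theorem integral_span_of_integral (hrat : IsRationalCone src)
    (hint : ∀ x ∈ src, x ∈ latticeN κ₁ → toLin x ∈ latticeN κ₂) :
    ∀ x ∈ Submodule.span ℚ (src : Set (κ₁ → ℚ)), x ∈ latticeN κ₁ → toLin x ∈ latticeN κ₂ := by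
  intro x hx hxN
  obtain ⟨a, ha, b, hb, haN, hbN, rfl⟩ := exists_sub_of_mem_span_of_mem_latticeN hrat hx hxN
  rw [map_sub]
  exact (latticeN κ₂).sub_mem (hint a ha haN) (hint b hb hbN)

/-- **Every lattice point of the image span has a lattice preimage in the source span**, for a
rational target cone and an inverse map integral on the target.
[cite: KempfEtAl1973, Ch. II §1 Def. 5] -/
theorem exists_latticeN_preimage_of_inv (hrat' : IsRationalCone tgt) (hmap : src.map toLin = tgt)
    (hmapsInv : ∀ y ∈ tgt, invLin y ∈ src) (hright : ∀ y ∈ tgt, toLin (invLin y) = y)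
    (hint' : ∀ y ∈ tgt, y ∈ latticeN κ₂ → invLin y ∈ latticeN κ₁) :
    ∀ y ∈ latticeN κ₂, y ∈ (Submodule.span ℚ (src : Set (κ₁ → ℚ))).map toLin →
      ∃ x ∈ Submodule.span ℚ (src : Set (κ₁ → ℚ)), x ∈ latticeN κ₁ ∧ toLin x = y := by
  intro y hyN hy
  rw [map_span_eq_of_map_eq hmap] at hy
  obtain ⟨a, ha, b, hb, haN, hbN, rfl⟩ := exists_sub_of_mem_span_of_mem_latticeN hrat' hy hyN
  refine ⟨invLin (a - b), ?_, ?_, ?_⟩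
  · rw [map_sub]
    exact Submodule.sub_mem _ (Submodule.subset_span (hmapsInv a ha))
      (Submodule.subset_span (hmapsInv b hb))
  · rw [map_sub]; exact (latticeN κ₁).sub_mem (hint' a ha haN) (hint' b hb hbN)
  · rw [map_sub, map_sub, hright a ha, hright b hb]

/-- The image of the image: `(ρ'.map invLin).map toLin = ρ'` for `ρ' ≤ tgt`.
[cite: KempfEtAl1973, Ch. II §1 Def. 5] -/
theorem map_map_eq_of_rightInv (hright : ∀ y ∈ tgt, toLin (invLin y) = y)
    {ρ' : PointedCone ℚ (κ₂ → ℚ)} (hρ' : ρ' ≤ tgt) : (ρ'.map invLin).map toLin = ρ' := by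
  ext y
  constructor
  · intro hy
    obtain ⟨z, hz, rfl⟩ := PointedCone.mem_map.mp hy
    obtain ⟨y', hy', rfl⟩ := PointedCone.mem_map.mp hz
    rw [hright y' (hρ' hy')]; exact hy'
  · intro hy
    exact PointedCone.mem_map.mpr ⟨invLin y, PointedCone.mem_map.mpr ⟨y, hy, rfl⟩, hright y (hρ' hy)⟩

end ConeIso

/-! ## Iterated star subdivisions through linked points -/

section Iterated

variable {𝕜 : Type*} [Field 𝕜] [LinearOrder 𝕜] [IsStrictOrderedRing 𝕜]
variable {κ κ' : Type*}

namespace Fan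

/-- Points outside a set containing the support can be dropped from an iterated star subdivision
(a star subdivision through a vector outside the support changes nothing).
[cite: Fulton1993Toric, §2.6 p. 47] -/
theorem starIter_filter_cones {σ : PointedCone 𝕜 (κ → 𝕜)} [DecidablePred (· ∈ σ)] :
    ∀ (l : List (κ → 𝕜)) {Γ : Fan 𝕜 (κ → 𝕜)}, Γ.support ⊆ (σ : Set (κ → 𝕜)) →
      (Γ.starIter (l.filter (· ∈ σ))).cones = (Γ.starIter l).cones
  | [], _, _ => rfl
  | z :: l, Γ, hΓ => by
    by_cases hz : z ∈ σ
    · rw [List.filter_cons_of_pos (by simpa using hz), starIter_cons, starIter_cons]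
      exact starIter_filter_cones l ((Γ.starSubdivision_support_subset z).trans hΓ)
    · rw [List.filter_cons_of_neg (by simpa using hz), starIter_cons, starIter_filter_cones l hΓ]
      exact starIter_cones_congr l
        (starSubdivision_cones_of_not_mem_support fun h => hz (hΓ h)).symm

variable [Fintype κ] [Fintype κ']
variable {Δ : Fan 𝕜 (κ → 𝕜)} {E : (κ → 𝕜) →ₗ[𝕜] (κ' → 𝕜)} {U : Submodule 𝕜 (κ → 𝕜)}
  {hinj : ∀ x ∈ U, E x = 0 → x = 0}

omit [Fintype κ'] in
/-- Inside a covered cone `τ`, an iterated star subdivision through nonzero vectors is the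
iterated star subdivision of the restricted fan through the vectors lying in `τ`.
[cite: Fulton1993Toric, §2.6 p. 47] -/
theorem restrict_starIter_cones_eq_filter {τ : PointedCone 𝕜 (κ → 𝕜)} [DecidablePred (· ∈ τ)]
    {l : List (κ → 𝕜)} (hl : ∀ z ∈ l, z ≠ 0)
    (hcov : (τ : Set (κ → 𝕜)) ⊆ (Δ.restrict τ).support) :
    ((Δ.starIter l).restrict τ).cones = ((Δ.restrict τ).starIter (l.filter (· ∈ τ))).cones := by
  rw [restrict_starIter_cones l hl hcov, starIter_filter_cones l (restrict_support_subset τ)]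

omit [Fintype κ'] in
/-- The covering of a cone by the cones inside it persists under iterated star subdivisions
through nonzero vectors. [cite: Fulton1993Toric, §2.6 p. 47] -/
theorem subset_support_restrict_starIter {τ : PointedCone 𝕜 (κ → 𝕜)} {l : List (κ → 𝕜)}
    (hl : ∀ z ∈ l, z ≠ 0) (hcov : (τ : Set (κ → 𝕜)) ⊆ (Δ.restrict τ).support) :
    (τ : Set (κ → 𝕜)) ⊆ ((Δ.starIter l).restrict τ).support := by
  rw [support_congr (restrict_starIter_cones l hl hcov), starIter_support_eq l hl]; exact hcov

omit [Fintype κ'] in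
/-- **Transport of an iterated star subdivision inside a linked cell.** Under compatibility of
the cones inside `τ ⊆ U` with the cones of `Δ'` inside `τ'`, the cones inside `τ` of the iterated
star subdivision of `Δ` through nonzero vectors are carried by `E` onto the cones of the
iterated star subdivision of `Δ'.restrict τ'` through the images of the vectors lying in `τ`
(in the same order). [cite: KempfEtAl1973, Ch. II §2 Thm. 4*] -/
theorem mapOn_restrict_starIter_cones {Δ' : Fan 𝕜 (κ' → 𝕜)} {τ : PointedCone 𝕜 (κ → 𝕜)}
    {τ' : PointedCone 𝕜 (κ' → 𝕜)} [DecidablePred (· ∈ τ)] (hτU : (τ : Set (κ → 𝕜)) ⊆ U)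
    (hcov : (τ : Set (κ → 𝕜)) ⊆ (Δ.restrict τ).support)
    (hcompat : ((Δ.restrict τ).mapOn E (Δ.conesSubset_restrict_of_subset hτU) hinj).cones =
      (Δ'.restrict τ').cones)
    {l : List (κ → 𝕜)} (hl : ∀ z ∈ l, z ≠ 0) :
    (((Δ.starIter l).restrict τ).mapOn E ((Δ.starIter l).conesSubset_restrict_of_subset hτU)
        hinj).cones = ((Δ'.restrict τ').starIter ((l.filter (· ∈ τ)).map E)).cones := by
  have hfan : (Δ.restrict τ).mapOn E (Δ.conesSubset_restrict_of_subset hτU) hinj =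
      Δ'.restrict τ' := eq_of_cones_eq hcompat
  have hlU : ∀ z ∈ l.filter (· ∈ τ), z ∈ U := fun z hz =>
    hτU (by simpa using (List.mem_filter.mp hz).2)
  rw [mapOn_cones_congr
      (hΔ' := (Δ.conesSubset_restrict_of_subset hτU).starIter (l.filter (· ∈ τ)))
      (hinj' := hinj) (restrict_starIter_cones_eq_filter hl hcov),
    mapOn_starIter_cones (l.filter (· ∈ τ)) hlU (Δ.conesSubset_restrict_of_subset hτU), hfan]

/-- **Link-compatibility survives iterated star subdivisions through corresponding points, same
order**: if the vectors of `l'` lying in `τ'` are, in order, the images of the vectors of `l`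
lying in `τ`, then after the iterated star subdivisions through `l` on one side and `l'` on the
other the cones inside `τ` are again carried exactly onto the cones inside `τ'`.
[cite: KempfEtAl1973, Ch. II §2 Thm. 4*] -/
theorem mapOn_restrict_starIter_cones_of_filter_eq {Δ' : Fan 𝕜 (κ' → 𝕜)}
    {τ : PointedCone 𝕜 (κ → 𝕜)} {τ' : PointedCone 𝕜 (κ' → 𝕜)} [DecidablePred (· ∈ τ)]
    [DecidablePred (· ∈ τ')] (hτU : (τ : Set (κ → 𝕜)) ⊆ U) (hττ' : τ.map E = τ')
    (hcov : (τ : Set (κ → 𝕜)) ⊆ (Δ.restrict τ).support)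
    (hcompat : ((Δ.restrict τ).mapOn E (Δ.conesSubset_restrict_of_subset hτU) hinj).cones =
      (Δ'.restrict τ').cones)
    {l : List (κ → 𝕜)} {l' : List (κ' → 𝕜)} (hl : ∀ z ∈ l, z ≠ 0) (hl' : ∀ w ∈ l', w ≠ 0)
    (hord : l'.filter (· ∈ τ') = (l.filter (· ∈ τ)).map E) :
    (((Δ.starIter l).restrict τ).mapOn E ((Δ.starIter l).conesSubset_restrict_of_subset hτU)
        hinj).cones = ((Δ'.starIter l').restrict τ').cones := by
  have hcov' : (τ' : Set (κ' → 𝕜)) ⊆ (Δ'.restrict τ').support := by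
    rw [← support_congr hcompat, mapOn_support, ← hττ', PointedCone.coe_map]
    exact Set.image_mono hcov
  rw [mapOn_restrict_starIter_cones hτU hcov hcompat hl, restrict_starIter_cones_eq_filter hl' hcov',
    hord]

/-- **Link-compatibility survives iterated star subdivisions through corresponding SEPARATED
points, in any order**: if the vectors of `l'` lying in `τ'` are exactly the images of the vectors
of `l` lying in `τ` (as sets; `l`, `l'` duplicate-free) and no cone of `Δ'` contains two distinct
vectors of `l'` (so that the star subdivisions through them commute,
`Fan.starIter_cones_eq_of_separated`), then after the iterated star subdivisions through `l` and
`l'` the cones inside `τ` are again carried exactly onto the cones inside `τ'`. This is the form in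
which the synchronised subdivision of [KempfEtAl1973] II §2 (subdivide at a whole orbit of points
under the links at once) keeps the charts compatible. [cite: KempfEtAl1973, Ch. II §2 Thm. 4*] -/
theorem mapOn_restrict_starIter_cones_of_separated {Δ' : Fan 𝕜 (κ' → 𝕜)}
    {τ : PointedCone 𝕜 (κ → 𝕜)} {τ' : PointedCone 𝕜 (κ' → 𝕜)} (hτU : (τ : Set (κ → 𝕜)) ⊆ U)
    (hττ' : τ.map E = τ') (hcov : (τ : Set (κ → 𝕜)) ⊆ (Δ.restrict τ).support)
    (hcompat : ((Δ.restrict τ).mapOn E (Δ.conesSubset_restrict_of_subset hτU) hinj).cones =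
      (Δ'.restrict τ').cones)
    {l : List (κ → 𝕜)} {l' : List (κ' → 𝕜)} (hl : ∀ z ∈ l, z ≠ 0) (hl' : ∀ w ∈ l', w ≠ 0)
    (hnd : l.Nodup) (hnd' : l'.Nodup)
    (hmatch : ∀ w, w ∈ l' ∧ w ∈ τ' ↔ ∃ z ∈ l, z ∈ τ ∧ E z = w)
    (hsep : ∀ σ ∈ Δ'.cones, ∀ w ∈ l', ∀ w' ∈ l', w ∈ σ → w' ∈ σ → w = w') :
    (((Δ.starIter l).restrict τ).mapOn E ((Δ.starIter l).conesSubset_restrict_of_subset hτU)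
        hinj).cones = ((Δ'.starIter l').restrict τ').cones := by
  classical
  have hcov' : (τ' : Set (κ' → 𝕜)) ⊆ (Δ'.restrict τ').support := by
    rw [← support_congr hcompat, mapOn_support, ← hττ', PointedCone.coe_map]
    exact Set.image_mono hcov
  rw [mapOn_restrict_starIter_cones hτU hcov hcompat hl, restrict_starIter_cones_eq_filter hl' hcov']
  refine (starIter_cones_eq_of_separated (hnd'.filter _) ?_ (fun w => ?_) ?_).symm
  · refine (hnd.filter _).map_on fun x hx y hy hxy => ?_
    exact eq_of_map_eq_of_mem hinj (hτU (by simpa using (List.mem_filter.mp hx).2))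
      (hτU (by simpa using (List.mem_filter.mp hy).2)) hxy
  · constructor
    · intro hw
      obtain ⟨hwl, hwτ⟩ := List.mem_filter.mp hw
      obtain ⟨z, hz, hzτ, rfl⟩ := (hmatch w).mp ⟨hwl, by simpa using hwτ⟩
      exact List.mem_map.mpr ⟨z, List.mem_filter.mpr ⟨hz, by simpa using hzτ⟩, rfl⟩
    · intro hw
      obtain ⟨z, hz, rfl⟩ := List.mem_map.mp hw
      obtain ⟨hzl, hzτ⟩ := List.mem_filter.mp hz
      obtain ⟨hwl, hwτ⟩ := (hmatch (E z)).mpr ⟨z, hzl, by simpa using hzτ, rfl⟩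
      exact List.mem_filter.mpr ⟨hwl, by simpa using hwτ⟩
  · intro σ hσ w hw w' hw' hwσ hw'σ
    exact hsep σ hσ.1 w (List.mem_filter.mp hw).1 w' (List.mem_filter.mp hw').1 hwσ hw'σ

end Fan

end Iterated

/-! ## Links of one fan -/

section OneFan

variable {κ : Type*} {Δ₀ : Fan ℚ (κ → ℚ)}

namespace Fan.Link

variable (ℓ : Δ₀.Link)

/-- A link is injective on the span of its source (kernel form of the transport hypothesis).
[cite: KempfEtAl1973, Ch. II §1 Def. 5] -/
theorem eq_zero_of_toLin_eq_zero :
    ∀ x ∈ Submodule.span ℚ (ℓ.src : Set (κ → ℚ)), ℓ.toLin x = 0 → x = 0 :=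
  eq_zero_of_map_eq_zero_of_leftInv ℓ.left_inv

/-- The inverse identity on the span of the source. [cite: KempfEtAl1973, Ch. II §1 Def. 5] -/
theorem invLin_toLin_of_mem_span {x : κ → ℚ} (hx : x ∈ Submodule.span ℚ (ℓ.src : Set (κ → ℚ))) :
    ℓ.invLin (ℓ.toLin x) = x :=
  leftInv_of_mem_span ℓ.left_inv hx

/-- A link carries the span of its source onto the span of its target.
[cite: KempfEtAl1973, Ch. II §1 Def. 5] -/
theorem map_span_src :
    (Submodule.span ℚ (ℓ.src : Set (κ → ℚ))).map ℓ.toLin = Submodule.span ℚ (ℓ.tgt : Set (κ → ℚ)) :=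
  map_span_eq_of_map_eq ℓ.map_src

/-- **A link of a rational fan maps the lattice points of `span src` to lattice points.**
[cite: KempfEtAl1973, Ch. II §1 Def. 5] -/
theorem integral_span (hΔ₀ : Δ₀.IsRational) :
    ∀ x ∈ Submodule.span ℚ (ℓ.src : Set (κ → ℚ)), x ∈ latticeN κ → ℓ.toLin x ∈ latticeN κ :=
  integral_span_of_integral (hΔ₀ ℓ.src_mem) ℓ.integral

/-- **Every lattice point of `toLin (span src)` is the image of a lattice point of `span src`.**
[cite: KempfEtAl1973, Ch. II §1 Def. 5] -/
theorem exists_latticeN_preimage (hΔ₀ : Δ₀.IsRational) :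
    ∀ y ∈ latticeN κ, y ∈ (Submodule.span ℚ (ℓ.src : Set (κ → ℚ))).map ℓ.toLin →
      ∃ x ∈ Submodule.span ℚ (ℓ.src : Set (κ → ℚ)), x ∈ latticeN κ ∧ ℓ.toLin x = y :=
  exists_latticeN_preimage_of_inv (hΔ₀ ℓ.tgt_mem) ℓ.map_src ℓ.mapsTo_inv ℓ.right_inv ℓ.integral_inv

/-- The inverse link, unfolded: `ℓ.symm.toLin = ℓ.invLin`, `ℓ.symm.src = ℓ.tgt`, `ℓ.symm.tgt = ℓ.src`.
[cite: KempfEtAl1973, Ch. II §1 Def. 5] -/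
theorem symm_toLin : ℓ.symm.toLin = ℓ.invLin := rfl

/-- See `symm_toLin`. [cite: KempfEtAl1973, Ch. II §1 Def. 5] -/
theorem symm_src : ℓ.symm.src = ℓ.tgt := rfl

/-- See `symm_toLin`. [cite: KempfEtAl1973, Ch. II §1 Def. 5] -/
theorem symm_tgt : ℓ.symm.tgt = ℓ.src := rfl

/-- **A link carries the faces of its source to cones of the fan** (they are faces of the target).
[cite: KempfEtAl1973, Ch. II §1 Def. 5] -/
theorem map_mem_cones_of_le {φ : PointedCone ℚ (κ → ℚ)} (hφ : φ ∈ Δ₀.cones) (hle : φ ≤ ℓ.src) :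
    φ.map ℓ.toLin ∈ Δ₀.cones := by
  have hface : (φ.map ℓ.toLin).IsFaceOf (ℓ.src.map ℓ.toLin) :=
    isFaceOf_map_of_isFaceOf ℓ.eq_zero_of_toLin_eq_zero (Δ₀.isFaceOf_of_le ℓ.src_mem hφ hle)
      Submodule.subset_span
  rw [ℓ.map_src] at hface
  exact Δ₀.face_mem ℓ.tgt_mem hface

/-- The image of a sub-cone of the source lies in the target. [cite: KempfEtAl1973, Ch. II §1 Def. 5] -/
theorem map_le_tgt {φ : PointedCone ℚ (κ → ℚ)} (hle : φ ≤ ℓ.src) : φ.map ℓ.toLin ≤ ℓ.tgt := by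
  rw [← ℓ.map_src]; exact map_mono' ℓ.toLin hle

/-- **Barycentres are link-equivariant**: for a cone `φ ≤ src` of the rational fan,
`bary (φ.map toLin) = toLin (bary φ)`. [cite: KempfEtAl1973, Ch. II §2 Thm. 4*] -/
theorem bary_map (hΔ₀ : Δ₀.IsRational) {φ : PointedCone ℚ (κ → ℚ)} (hφ : φ ∈ Δ₀.cones)
    (hle : φ ≤ ℓ.src) : bary (φ.map ℓ.toLin) = ℓ.toLin (bary φ) := by
  classical
  exact PolyhedralFans.bary_map ℓ.eq_zero_of_toLin_eq_zero (ℓ.integral_span hΔ₀)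
    (ℓ.exists_latticeN_preimage hΔ₀) (fun _ hx => Submodule.subset_span (hle hx)) (Δ₀.fg hφ)

/-- The barycentre of the target is the image of the barycentre of the source.
[cite: KempfEtAl1973, Ch. II §2 Thm. 4*] -/
theorem bary_tgt (hΔ₀ : Δ₀.IsRational) : bary ℓ.tgt = ℓ.toLin (bary ℓ.src) := by
  rw [← ℓ.map_src]; exact ℓ.bary_map hΔ₀ ℓ.src_mem le_rfl

/-- **Primitive ray generators are link-equivariant.** [cite: KempfEtAl1973, Ch. II §2 Thm. 4*] -/
theorem primRayGens_map [DecidableEq (κ → ℚ)] (hΔ₀ : Δ₀.IsRational) {φ : PointedCone ℚ (κ → ℚ)}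
    (hφ : φ ∈ Δ₀.cones) (hle : φ ≤ ℓ.src) :
    primRayGens (φ.map ℓ.toLin) = (primRayGens φ).image ℓ.toLin :=
  PolyhedralFans.primRayGens_map ℓ.eq_zero_of_toLin_eq_zero (ℓ.integral_span hΔ₀)
    (ℓ.exists_latticeN_preimage hΔ₀) (fun _ hx => Submodule.subset_span (hle hx)) (Δ₀.fg hφ)

/-- **The cone count is link-invariant** for cones inside the source with a primitive simplicial
generating set (e.g. cones of a primitively simplicial refinement).
[cite: KempfEtAl1973, Ch. II §2 Thm. 11*] -/
theorem conePMult_map (hΔ₀ : Δ₀.IsRational) {ρ : PointedCone ℚ (κ → ℚ)}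
    {S : Finset (κ → ℚ)} (hρ : ρ ≤ ℓ.src) (hS : IsPrimGens ρ S) :
    conePMult (ρ.map ℓ.toLin) = conePMult ρ := by
  classical
  exact PolyhedralFans.conePMult_map ℓ.eq_zero_of_toLin_eq_zero (ℓ.integral_span hΔ₀)
    (ℓ.exists_latticeN_preimage hΔ₀) (fun _ hx => Submodule.subset_span (hρ hx)) hS

end Fan.Link

namespace Fan

variable (ℓ : Δ₀.Link)

/-- **Two-sided link-compatibility is the cone-set equality of the transport lemmas**: `Δ'` is
compatible with `ℓ` and with `ℓ.symm` iff the image fan of `Δ'.restrict src` under `toLin` has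
exactly the cones of `Δ'.restrict tgt`. [cite: KempfEtAl1973, Ch. II §1 Def. 5 and §2] -/
theorem linkCompatible_and_symm_iff {Δ' : Fan ℚ (κ → ℚ)} :
    Fan.LinkCompatible Δ' ℓ ∧ Fan.LinkCompatible Δ' ℓ.symm ↔
      ((Δ'.restrict ℓ.src).mapOn ℓ.toLin (Δ'.conesSubset_restrict_span ℓ.src)
          ℓ.eq_zero_of_toLin_eq_zero).cones = (Δ'.restrict ℓ.tgt).cones := by
  constructor
  · rintro ⟨h, hsymm⟩
    apply le_antisymm
    · rintro _ ⟨ρ, hρ, rfl⟩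
      exact h ρ hρ
    · intro ρ' hρ'
      have h1 : ρ'.map ℓ.invLin ∈ (Δ'.restrict ℓ.src).cones := hsymm ρ' hρ'
      exact ⟨ρ'.map ℓ.invLin, h1, map_map_eq_of_rightInv ℓ.right_inv hρ'.2⟩
  · intro heq
    refine ⟨fun ρ hρ => ?_, fun ρ' hρ' => ?_⟩
    · rw [← heq]; exact map_mem_mapOn hρ
    · change ρ' ∈ (Δ'.restrict ℓ.tgt).cones at hρ'
      rw [← heq] at hρ'
      obtain ⟨ρ, hρ, rfl⟩ := hρ'
      have hback : (ρ.map ℓ.toLin).map ℓ.invLin = ρ := by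
        rw [PointedCone.map_map]
        ext x
        constructor
        · intro hx
          obtain ⟨y, hy, rfl⟩ := PointedCone.mem_map.mp hx
          change ℓ.invLin (ℓ.toLin y) ∈ ρ
          rw [ℓ.left_inv y (hρ.2 hy)]; exact hy
        · intro hx
          exact PointedCone.mem_map.mpr ⟨x, hx, ℓ.left_inv x (hρ.2 hx)⟩
      change (ρ.map ℓ.toLin).map ℓ.invLin ∈ (Δ'.restrict ℓ.src).cones
      rw [hback]; exact hρ

/-- **Link-compatibility survives a linked star subdivision**: if `Δ'` refines the source cone
(its cones inside `src` cover `src`) and is compatible with `ℓ` and `ℓ.symm`, then after the star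
subdivisions at `v ∈ src` and at `toLin v` the cones inside `src` are again carried exactly onto
the cones inside `tgt`. (For `v ≠ toLin v` the two subdivisions are performed one after the
other; that the second does not disturb the cones inside `src` when `toLin v ∉ src` is
`restrict_starSubdivision_cones_of_not_mem`.) [cite: KempfEtAl1973, Ch. II §2 Thm. 4*] -/
theorem linkCompatible_starSubdivision_cones {Δ' : Fan ℚ (κ → ℚ)}
    (hcov : (ℓ.src : Set (κ → ℚ)) ⊆ (Δ'.restrict ℓ.src).support)
    (hcompat : Fan.LinkCompatible Δ' ℓ ∧ Fan.LinkCompatible Δ' ℓ.symm) {v : κ → ℚ} (hv : v ∈ ℓ.src) :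
    (((Δ'.starSubdivision v).restrict ℓ.src).mapOn ℓ.toLin
        ((Δ'.starSubdivision v).conesSubset_restrict_of_subset Submodule.subset_span)
        ℓ.eq_zero_of_toLin_eq_zero).cones =
      ((Δ'.starSubdivision (ℓ.toLin v)).restrict ℓ.tgt).cones :=
  mapOn_restrict_starSubdivision_cones Submodule.subset_span ℓ.map_src hcov
    ((linkCompatible_and_symm_iff ℓ).mp hcompat) hv

/-- **The `v`-coordinate takes equal values at linked points**: under two-sided compatibility and
covering, `starCoord_{toLin v} (toLin x) = starCoord_v x` for `v, x ∈ src`, `v ≠ 0`.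
[cite: KempfEtAl1973, Ch. II §2 Thm. 9*] -/
theorem starCoord_eq_of_linkCompatible [Fintype κ] {Δ' : Fan ℚ (κ → ℚ)}
    (hcov : (ℓ.src : Set (κ → ℚ)) ⊆ (Δ'.restrict ℓ.src).support)
    (hcompat : Fan.LinkCompatible Δ' ℓ ∧ Fan.LinkCompatible Δ' ℓ.symm) {v x : κ → ℚ}
    (hv : v ∈ ℓ.src) (hv0 : v ≠ 0) (hx : x ∈ ℓ.src) :
    Δ'.starCoord (ℓ.toLin v) (ℓ.toLin x) = Δ'.starCoord v x :=
  starCoord_map_eq_of_compat Submodule.subset_span hcov ((linkCompatible_and_symm_iff ℓ).mp hcompat)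
    hv hv0 hx

/-- The covering of the source cell persists under iterated star subdivisions through nonzero
vectors. [cite: Fulton1993Toric, §2.6 p. 47] -/
theorem Link.subset_support_restrict_starIter [Fintype κ] {Δ' : Fan ℚ (κ → ℚ)}
    (hcov : (ℓ.src : Set (κ → ℚ)) ⊆ (Δ'.restrict ℓ.src).support) {l : List (κ → ℚ)}
    (hl : ∀ z ∈ l, z ≠ 0) :
    (ℓ.src : Set (κ → ℚ)) ⊆ ((Δ'.starIter l).restrict ℓ.src).support :=
  Fan.subset_support_restrict_starIter hl hcov

/-- **Two-sided link-compatibility survives the simultaneous star subdivision through a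
link-closed separated set of points.** If `Δ'` covers the source cell and is compatible with `ℓ`
and `ℓ.symm`, `l` is a duplicate-free list of nonzero vectors, the vectors of `l` in `tgt` are
exactly the images of the vectors of `l` in `src`, and no cone of `Δ'` contains two distinct
vectors of `l`, then `Δ'.starIter l` is again compatible with `ℓ` and `ℓ.symm`
([KempfEtAl1973] II §2: the subdivision is performed on all charts at once).
[cite: KempfEtAl1973, Ch. II §2 Thm. 4*] -/
theorem linkCompatible_starIter [Fintype κ] {Δ' : Fan ℚ (κ → ℚ)}
    (hcov : (ℓ.src : Set (κ → ℚ)) ⊆ (Δ'.restrict ℓ.src).support)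
    (hcompat : Fan.LinkCompatible Δ' ℓ ∧ Fan.LinkCompatible Δ' ℓ.symm) {l : List (κ → ℚ)}
    (hl : ∀ z ∈ l, z ≠ 0) (hnd : l.Nodup)
    (hclosed : ∀ w, w ∈ l ∧ w ∈ ℓ.tgt ↔ ∃ z ∈ l, z ∈ ℓ.src ∧ ℓ.toLin z = w)
    (hsep : ∀ σ ∈ Δ'.cones, ∀ w ∈ l, ∀ w' ∈ l, w ∈ σ → w' ∈ σ → w = w') :
    Fan.LinkCompatible (Δ'.starIter l) ℓ ∧ Fan.LinkCompatible (Δ'.starIter l) ℓ.symm :=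
  (linkCompatible_and_symm_iff ℓ).mpr
    (mapOn_restrict_starIter_cones_of_separated Submodule.subset_span ℓ.map_src hcov
      ((linkCompatible_and_symm_iff ℓ).mp hcompat) hl hl hnd hnd hclosed hsep)

end Fan

end OneFan

/-! ## Links of a family of fans -/

section Family

variable {ι : Type*} {n : ι → ℕ} {Δ₀ : ∀ i, Fan ℚ (Fin (n i) → ℚ)}

namespace Fan.FamilyLink

variable (ℓ : Fan.FamilyLink n Δ₀)

/-- A family link is injective on the span of its source (kernel form).
[cite: KempfEtAl1973, Ch. II §1 Def. 5] -/
theorem eq_zero_of_toLin_eq_zero :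
    ∀ x ∈ Submodule.span ℚ (ℓ.src : Set (Fin (n ℓ.i) → ℚ)), ℓ.toLin x = 0 → x = 0 :=
  eq_zero_of_map_eq_zero_of_leftInv ℓ.left_inv

/-- A family link carries `span src` onto `span tgt`. [cite: KempfEtAl1973, Ch. II §1 Def. 5] -/
theorem map_span_src :
    (Submodule.span ℚ (ℓ.src : Set (Fin (n ℓ.i) → ℚ))).map ℓ.toLin =
      Submodule.span ℚ (ℓ.tgt : Set (Fin (n ℓ.j) → ℚ)) :=
  map_span_eq_of_map_eq (map_eq_of_mapsTo ℓ.mapsTo ℓ.mapsTo_inv ℓ.right_inv)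

/-- **A family link of rational fans maps the lattice points of `span src` to lattice points.**
[cite: KempfEtAl1973, Ch. II §1 Def. 5] -/
theorem integral_span (hΔ₀ : ∀ i, (Δ₀ i).IsRational) :
    ∀ x ∈ Submodule.span ℚ (ℓ.src : Set (Fin (n ℓ.i) → ℚ)), x ∈ latticeN (Fin (n ℓ.i)) →
      ℓ.toLin x ∈ latticeN (Fin (n ℓ.j)) :=
  integral_span_of_integral ((hΔ₀ ℓ.i) ℓ.src_mem) ℓ.integral

/-- **Every lattice point of `toLin (span src)` comes from a lattice point of `span src`.**
[cite: KempfEtAl1973, Ch. II §1 Def. 5] -/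
theorem exists_latticeN_preimage (hΔ₀ : ∀ i, (Δ₀ i).IsRational) :
    ∀ y ∈ latticeN (Fin (n ℓ.j)), y ∈ (Submodule.span ℚ (ℓ.src : Set (Fin (n ℓ.i) → ℚ))).map ℓ.toLin →
      ∃ x ∈ Submodule.span ℚ (ℓ.src : Set (Fin (n ℓ.i) → ℚ)), x ∈ latticeN (Fin (n ℓ.i)) ∧
        ℓ.toLin x = y :=
  exists_latticeN_preimage_of_inv ((hΔ₀ ℓ.j) ℓ.tgt_mem) (map_eq_of_mapsTo ℓ.mapsTo ℓ.mapsTo_inv ℓ.right_inv) ℓ.mapsTo_inv ℓ.right_inv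
    ℓ.integral_inv

/-- **A family link carries the faces of its source to cones of the target fan.**
[cite: KempfEtAl1973, Ch. II §1 Def. 5] -/
theorem map_mem_cones_of_le {φ : PointedCone ℚ (Fin (n ℓ.i) → ℚ)} (hφ : φ ∈ (Δ₀ ℓ.i).cones)
    (hle : φ ≤ ℓ.src) : φ.map ℓ.toLin ∈ (Δ₀ ℓ.j).cones := by
  have hface : (φ.map ℓ.toLin).IsFaceOf (ℓ.src.map ℓ.toLin) :=
    isFaceOf_map_of_isFaceOf ℓ.eq_zero_of_toLin_eq_zero ((Δ₀ ℓ.i).isFaceOf_of_le ℓ.src_mem hφ hle)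
      Submodule.subset_span
  rw [map_eq_of_mapsTo ℓ.mapsTo ℓ.mapsTo_inv ℓ.right_inv] at hface
  exact (Δ₀ ℓ.j).face_mem ℓ.tgt_mem hface

/-- **Barycentres are equivariant under family links.** [cite: KempfEtAl1973, Ch. II §2 Thm. 4*] -/
theorem bary_map (hΔ₀ : ∀ i, (Δ₀ i).IsRational) {φ : PointedCone ℚ (Fin (n ℓ.i) → ℚ)}
    (hφ : φ ∈ (Δ₀ ℓ.i).cones) (hle : φ ≤ ℓ.src) : bary (φ.map ℓ.toLin) = ℓ.toLin (bary φ) :=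
  PolyhedralFans.bary_map ℓ.eq_zero_of_toLin_eq_zero (ℓ.integral_span hΔ₀)
    (ℓ.exists_latticeN_preimage hΔ₀) (fun _ hx => Submodule.subset_span (hle hx)) ((Δ₀ ℓ.i).fg hφ)

/-- **The cone count is invariant under family links.** [cite: KempfEtAl1973, Ch. II §2 Thm. 11*] -/
theorem conePMult_map (hΔ₀ : ∀ i, (Δ₀ i).IsRational) {ρ : PointedCone ℚ (Fin (n ℓ.i) → ℚ)}
    {S : Finset (Fin (n ℓ.i) → ℚ)} (hρ : ρ ≤ ℓ.src) (hS : IsPrimGens ρ S) :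
    conePMult (ρ.map ℓ.toLin) = conePMult ρ := by
  classical
  exact PolyhedralFans.conePMult_map ℓ.eq_zero_of_toLin_eq_zero (ℓ.integral_span hΔ₀)
    (ℓ.exists_latticeN_preimage hΔ₀) (fun _ hx => Submodule.subset_span (hρ hx)) hS

end Fan.FamilyLink

/-- **Two-sided family-link compatibility is the cone-set equality of the transport lemmas.**
[cite: KempfEtAl1973, Ch. II §1 Def. 5 and §2] -/
theorem Fan.familyLinkCompatible_and_symm_iff (ℓ : Fan.FamilyLink n Δ₀)
    {Δ' : ∀ i, Fan ℚ (Fin (n i) → ℚ)} :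
    Fan.FamilyLinkCompatible Δ' ℓ ∧ Fan.FamilyLinkCompatible Δ' ℓ.symm ↔
      (((Δ' ℓ.i).restrict ℓ.src).mapOn ℓ.toLin ((Δ' ℓ.i).conesSubset_restrict_span ℓ.src)
          ℓ.eq_zero_of_toLin_eq_zero).cones = ((Δ' ℓ.j).restrict ℓ.tgt).cones := by
  constructor
  · rintro ⟨h, hsymm⟩
    apply le_antisymm
    · rintro _ ⟨ρ, hρ, rfl⟩
      exact h ρ hρ
    · intro ρ' hρ'
      have h1 : ρ'.map ℓ.invLin ∈ ((Δ' ℓ.i).restrict ℓ.src).cones := hsymm ρ' hρ'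
      exact ⟨ρ'.map ℓ.invLin, h1, map_map_eq_of_rightInv ℓ.right_inv hρ'.2⟩
  · intro heq
    refine ⟨fun ρ hρ => ?_, fun ρ' hρ' => ?_⟩
    · rw [← heq]; exact Fan.map_mem_mapOn hρ
    · change ρ' ∈ ((Δ' ℓ.j).restrict ℓ.tgt).cones at hρ'
      rw [← heq] at hρ'
      obtain ⟨ρ, hρ, rfl⟩ := hρ'
      have hback : (ρ.map ℓ.toLin).map ℓ.invLin = ρ := by
        rw [PointedCone.map_map]
        ext x
        constructor
        · intro hx
          obtain ⟨y, hy, rfl⟩ := PointedCone.mem_map.mp hx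
          change ℓ.invLin (ℓ.toLin y) ∈ ρ
          rw [ℓ.left_inv y (hρ.2 hy)]; exact hy
        · intro hx
          exact PointedCone.mem_map.mpr ⟨x, hx, ℓ.left_inv x (hρ.2 hx)⟩
      change (ρ.map ℓ.toLin).map ℓ.invLin ∈ ((Δ' ℓ.i).restrict ℓ.src).cones
      rw [hback]; exact hρ

/-- **The `v`-coordinate takes equal values at points linked by a family link** (two-sided
compatibility and covering of the source cell). [cite: KempfEtAl1973, Ch. II §2 Thm. 9*] -/
theorem Fan.starCoord_eq_of_familyLinkCompatible (ℓ : Fan.FamilyLink n Δ₀)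
    {Δ' : ∀ i, Fan ℚ (Fin (n i) → ℚ)}
    (hcov : (ℓ.src : Set (Fin (n ℓ.i) → ℚ)) ⊆ ((Δ' ℓ.i).restrict ℓ.src).support)
    (hcompat : Fan.FamilyLinkCompatible Δ' ℓ ∧ Fan.FamilyLinkCompatible Δ' ℓ.symm)
    {v x : Fin (n ℓ.i) → ℚ} (hv : v ∈ ℓ.src) (hv0 : v ≠ 0) (hx : x ∈ ℓ.src) :
    (Δ' ℓ.j).starCoord (ℓ.toLin v) (ℓ.toLin x) = (Δ' ℓ.i).starCoord v x :=
  starCoord_map_eq_of_compat Submodule.subset_span hcov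
    ((Fan.familyLinkCompatible_and_symm_iff ℓ).mp hcompat) hv hv0 hx

/-- **Two-sided family-link compatibility survives the simultaneous star subdivisions through
link-closed separated lists of points** (member `i` subdivided through `l i`): the vectors of
`l ℓ.j` in `tgt` are exactly the images of the vectors of `l ℓ.i` in `src`, the lists are
duplicate-free and nonzero, and no cone of `Δ' ℓ.j` contains two distinct vectors of `l ℓ.j`.
[cite: KempfEtAl1973, Ch. II §2 Thm. 4*] -/
theorem Fan.familyLinkCompatible_starIter (ℓ : Fan.FamilyLink n Δ₀)
    {Δ' : ∀ i, Fan ℚ (Fin (n i) → ℚ)}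
    (hcov : (ℓ.src : Set (Fin (n ℓ.i) → ℚ)) ⊆ ((Δ' ℓ.i).restrict ℓ.src).support)
    (hcompat : Fan.FamilyLinkCompatible Δ' ℓ ∧ Fan.FamilyLinkCompatible Δ' ℓ.symm)
    {l : ∀ i, List (Fin (n i) → ℚ)} (hli : ∀ z ∈ l ℓ.i, z ≠ 0) (hlj : ∀ w ∈ l ℓ.j, w ≠ 0)
    (hndi : (l ℓ.i).Nodup) (hndj : (l ℓ.j).Nodup)
    (hclosed : ∀ w, w ∈ l ℓ.j ∧ w ∈ ℓ.tgt ↔ ∃ z ∈ l ℓ.i, z ∈ ℓ.src ∧ ℓ.toLin z = w)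
    (hsep : ∀ σ ∈ (Δ' ℓ.j).cones, ∀ w ∈ l ℓ.j, ∀ w' ∈ l ℓ.j, w ∈ σ → w' ∈ σ → w = w') :
    Fan.FamilyLinkCompatible (fun i => (Δ' i).starIter (l i)) ℓ ∧
      Fan.FamilyLinkCompatible (fun i => (Δ' i).starIter (l i)) ℓ.symm :=
  (Fan.familyLinkCompatible_and_symm_iff ℓ).mpr
    (Fan.mapOn_restrict_starIter_cones_of_separated Submodule.subset_span (map_eq_of_mapsTo ℓ.mapsTo ℓ.mapsTo_inv ℓ.right_inv) hcov
      ((Fan.familyLinkCompatible_and_symm_iff ℓ).mp hcompat) hli hlj hndi hndj hclosed hsep)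

/-- The covering of the source cell of a family link persists under iterated star subdivisions
through nonzero vectors. [cite: Fulton1993Toric, §2.6 p. 47] -/
theorem Fan.FamilyLink.subset_support_restrict_starIter (ℓ : Fan.FamilyLink n Δ₀)
    {Δ' : ∀ i, Fan ℚ (Fin (n i) → ℚ)}
    (hcov : (ℓ.src : Set (Fin (n ℓ.i) → ℚ)) ⊆ ((Δ' ℓ.i).restrict ℓ.src).support)
    {l : ∀ i, List (Fin (n i) → ℚ)} (hli : ∀ z ∈ l ℓ.i, z ≠ 0) :
    (ℓ.src : Set (Fin (n ℓ.i) → ℚ)) ⊆ (((Δ' ℓ.i).starIter (l ℓ.i)).restrict ℓ.src).support :=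
  Fan.subset_support_restrict_starIter hli hcov

end Family

end Literature.Geometry.PolyhedralFans

end
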